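import Summits.KontsevichZagierPeriods.KontsevichZagierPeriods.Theorems.HurwitzMicroSectorsNormalFormPrincipleDilogExistsBoxAtoms

/-!
# `NormalFormPrinciple` (stmt-KontsevichZagierPeriods-3869), line `SketchIdeator1` —
# leaf `stub_boxRigidity`, layer `M3`: the open unit cube is the decreasing simplex (rule 2)

Pure proof file (registered sub-goal `ebd_box_sub_simplex` of the layer `M3`, lead seat c9;
`--supports` the crux). In the EulerBoxDuality chain
`[(0,1)³, 1/((1−xy)(1−xyz))] ∼ [(0,1)³, 2/(1−xyz)]` (Euler's `ζ(2,1) = ζ(3)` in box form) the open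
unit cube `□³ = (0,1)³ ⊆ ℝ³` is carried onto the decreasing open simplex
`Δ = {0 < t₂ < t₁ < t₀ < 1}` by ONE change of variables of the Kontsevich–Zagier calculus
(rule (2), `KZ.changeOfVariablesRel`): the simplex chart

  `Φ(x₀, x₁, x₂) = (x₀, x₀x₁, x₀x₁x₂)`,
  `DΦ(x) = !![1, 0, 0; x₁, x₀, 0; x₁x₂, x₀x₂, x₀x₁]` (lower triangular),
  `|det DΦ(x)| = x₀² x₁ > 0` on `□³`,

with inverse `x₀ = t₀`, `x₁ = t₁/t₀`, `x₂ = t₂/t₁`, so that `Φ` is injective on `□³` and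
`Φ '' □³ = Δ`. `Φ` is a `ℚ`-polynomial map, hence `ℚ`-semialgebraic on `□³`
(`isSemialgebraicMapOn_aeval`). The statement is generic in the integrand `g` of the target
representation `T` on `Δ`: the hypothesis `N.integrand x = g (Φ x) · x₀²x₁` on `□³` is literally the
pull-back identity `N.integrand x = T.integrand (Φ x) · |det DΦ(x)|` demanded by rule (2). Pattern
of `AlgLevelTwo.lt2_exists_squaresChart` / `levelTwo_squares` (seat c8) and of
`Dilog.bss_exists_mergeScaleChart` (this line, layer `Dilog`).

References: M. Kontsevich, D. Zagier, *Periods* (2001), §1.1–1.2, rule (2). No definitions are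
introduced.
-/

noncomputable section

open MeasureTheory Set
open Literature.NumberTheory.Transcendental Literature.NumberTheory.Transcendental.KZ
open Literature.ModelTheory.ExponentialFields (IsSemialgebraic)

namespace Summit.KontsevichZagierPeriods.HurwitzMicroSectors.NormalFormPrinciple.PiBox.M3

/-! ## The simplex chart of the open unit cube -/

/-- **The simplex chart `Φ(x₀,x₁,x₂) = (x₀, x₀x₁, x₀x₁x₂)`** of the open unit cube `(0,1)³` onto the
decreasing open simplex `{0 < t₂ < t₁ < t₀ < 1}`: a `ℚ`-polynomial (hence `ℚ`-semialgebraic) map,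
differentiable with the lower-triangular derivative `!![1, 0, 0; x₁, x₀, 0; x₁x₂, x₀x₂, x₀x₁]` and
`|det DΦ| = x₀² x₁` on the cube, injective on the cube and ONTO the simplex (inverse
`t ↦ (t₀, t₁/t₀, t₂/t₁)`). [folklore] -/
theorem ebd1_exists_simplexChart :
    ∃ (Φ : (Fin 3 → ℝ) → (Fin 3 → ℝ)) (Φ' : (Fin 3 → ℝ) → (Fin 3 → ℝ) →L[ℝ] (Fin 3 → ℝ)),
      (∀ x, Φ x = ![x 0, x 0 * x 1, x 0 * x 1 * x 2]) ∧
      IsSemialgebraicMapOn ℚ {x : Fin 3 → ℝ | ∀ i, x i ∈ Set.Ioo (0:ℝ) 1} Φ ∧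
      (∀ x, HasFDerivAt Φ (Φ' x) x) ∧
      Set.InjOn Φ {x : Fin 3 → ℝ | ∀ i, x i ∈ Set.Ioo (0:ℝ) 1} ∧
      Φ '' {x : Fin 3 → ℝ | ∀ i, x i ∈ Set.Ioo (0:ℝ) 1} =
        {t | 0 < t 2 ∧ t 2 < t 1 ∧ t 1 < t 0 ∧ t 0 < 1} ∧
      (∀ x ∈ {x : Fin 3 → ℝ | ∀ i, x i ∈ Set.Ioo (0:ℝ) 1}, |(Φ' x).det| = x 0 ^ 2 * x 1) := by
  set Φ : (Fin 3 → ℝ) → (Fin 3 → ℝ) := fun x => ![x 0, x 0 * x 1, x 0 * x 1 * x 2]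
  set Φ' : (Fin 3 → ℝ) → (Fin 3 → ℝ) →L[ℝ] (Fin 3 → ℝ) := fun x =>
    LinearMap.toContinuousLinearMap
      (Matrix.toLin' !![(1:ℝ), 0, 0; x 1, x 0, 0; x 1 * x 2, x 0 * x 2, x 0 * x 1])
  have hΦ0 : ∀ x, Φ x 0 = x 0 := fun x => rfl
  have hΦ1 : ∀ x, Φ x 1 = x 0 * x 1 := fun x => rfl
  have hΦ2 : ∀ x, Φ x 2 = x 0 * x 1 * x 2 := fun x => rfl
  have hΦ'0 : ∀ x v : Fin 3 → ℝ, Φ' x v 0 = v 0 := by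
    intro x v
    change Matrix.toLin' !![(1:ℝ), 0, 0; x 1, x 0, 0; x 1 * x 2, x 0 * x 2, x 0 * x 1] v 0 = _
    rw [Matrix.toLin'_apply]
    simp [Matrix.mulVec, dotProduct, Fin.sum_univ_three]
  have hΦ'1 : ∀ x v : Fin 3 → ℝ, Φ' x v 1 = x 1 * v 0 + x 0 * v 1 := by
    intro x v
    change Matrix.toLin' !![(1:ℝ), 0, 0; x 1, x 0, 0; x 1 * x 2, x 0 * x 2, x 0 * x 1] v 1 = _
    rw [Matrix.toLin'_apply]
    simp [Matrix.mulVec, dotProduct, Fin.sum_univ_three]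
  have hΦ'2 : ∀ x v : Fin 3 → ℝ,
      Φ' x v 2 = x 1 * x 2 * v 0 + x 0 * x 2 * v 1 + x 0 * x 1 * v 2 := by
    intro x v
    change Matrix.toLin' !![(1:ℝ), 0, 0; x 1, x 0, 0; x 1 * x 2, x 0 * x 2, x 0 * x 1] v 2 = _
    rw [Matrix.toLin'_apply]
    simp [Matrix.mulVec, dotProduct, Fin.sum_univ_three]
  have hdet : ∀ x, (Φ' x).det = x 0 ^ 2 * x 1 := by
    intro x
    change LinearMap.det
      (Matrix.toLin' !![(1:ℝ), 0, 0; x 1, x 0, 0; x 1 * x 2, x 0 * x 2, x 0 * x 1]) = _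
    rw [LinearMap.det_toLin', Matrix.det_fin_three]
    simp only [Matrix.of_apply, Matrix.cons_val', Matrix.cons_val_zero, Matrix.cons_val_one,
      Matrix.cons_val_two, Matrix.empty_val', Matrix.cons_val_fin_one, Matrix.head_cons,
      Matrix.tail_cons, Matrix.head_fin_const]
    ring
  have hderiv : ∀ x, HasFDerivAt Φ (Φ' x) x := by
    intro x
    have h0 : HasFDerivAt (fun y : Fin 3 → ℝ => y 0)
        (ContinuousLinearMap.proj (R := ℝ) (φ := fun _ : Fin 3 => ℝ) 0) x := hasFDerivAt_apply 0 x
    have h1 : HasFDerivAt (fun y : Fin 3 → ℝ => y 1)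
        (ContinuousLinearMap.proj (R := ℝ) (φ := fun _ : Fin 3 => ℝ) 1) x := hasFDerivAt_apply 1 x
    have h2 : HasFDerivAt (fun y : Fin 3 → ℝ => y 2)
        (ContinuousLinearMap.proj (R := ℝ) (φ := fun _ : Fin 3 => ℝ) 2) x := hasFDerivAt_apply 2 x
    rw [hasFDerivAt_pi']
    refine Fin.forall_fin_succ.2 ⟨?_, Fin.forall_fin_two.2 ⟨?_, ?_⟩⟩
    · show HasFDerivAt (fun y : Fin 3 → ℝ => y 0) _ x
      refine h0.congr_fderiv (ContinuousLinearMap.ext fun v => ?_)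
      show v 0 = Φ' x v 0
      rw [hΦ'0]
    · show HasFDerivAt (fun y : Fin 3 → ℝ => y 0 * y 1) _ x
      refine (h0.mul h1).congr_fderiv (ContinuousLinearMap.ext fun v => ?_)
      show x 0 * v 1 + x 1 * v 0 = Φ' x v 1
      rw [hΦ'1]
      ring
    · show HasFDerivAt (fun y : Fin 3 → ℝ => y 0 * y 1 * y 2) _ x
      refine ((h0.mul h1).mul h2).congr_fderiv (ContinuousLinearMap.ext fun v => ?_)
      show x 0 * x 1 * v 2 + x 2 * (x 0 * v 1 + x 1 * v 0) = Φ' x v 2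
      rw [hΦ'2]
      ring
  refine ⟨Φ, Φ', fun x => rfl, ?_, hderiv, ?_, ?_, fun x hx => ?_⟩
  · -- a `ℚ`-polynomial map is `ℚ`-semialgebraic
    convert isSemialgebraicMapOn_aeval (isSemialgebraic_box 3)
      ![(MvPolynomial.X 0 : MvPolynomial (Fin 3) ℚ), MvPolynomial.X 0 * MvPolynomial.X 1,
        MvPolynomial.X 0 * MvPolynomial.X 1 * MvPolynomial.X 2] using 2 with x
    funext i
    fin_cases i
    · simp [hΦ0]
    · simp [hΦ1]
    · simp [hΦ2]
  · -- injective on the cube (`x₀ ≠ 0`, `x₀x₁ ≠ 0` there)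
    intro x hx y hy hxy
    have e0 : x 0 = y 0 := congrFun hxy 0
    have e1 : x 0 * x 1 = y 0 * y 1 := congrFun hxy 1
    have e2 : x 0 * x 1 * x 2 = y 0 * y 1 * y 2 := congrFun hxy 2
    rw [e0] at e1
    have h1 : x 1 = y 1 := mul_left_cancel₀ (hy 0).1.ne' e1
    rw [e0, h1] at e2
    have h2 : x 2 = y 2 := mul_left_cancel₀ (mul_ne_zero (hy 0).1.ne' (hy 1).1.ne') e2
    funext i
    fin_cases i
    · exact e0
    · exact h1
    · exact h2
  · -- onto the decreasing simplex
    ext t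
    constructor
    · rintro ⟨x, hx, rfl⟩
      have h01 : 0 < x 0 * x 1 := mul_pos (hx 0).1 (hx 1).1
      refine ⟨?_, ?_, ?_, ?_⟩
      · show 0 < x 0 * x 1 * x 2
        exact mul_pos h01 (hx 2).1
      · show x 0 * x 1 * x 2 < x 0 * x 1
        exact mul_lt_of_lt_one_right h01 (hx 2).2
      · show x 0 * x 1 < x 0
        exact mul_lt_of_lt_one_right (hx 0).1 (hx 1).2
      · show x 0 < 1
        exact (hx 0).2
    · rintro ⟨h2, h21, h10, h0⟩
      have ht1 : 0 < t 1 := h2.trans h21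
      have ht0 : 0 < t 0 := ht1.trans h10
      refine ⟨![t 0, t 1 / t 0, t 2 / t 1], ?_, ?_⟩
      · refine Fin.forall_fin_succ.2 ⟨⟨ht0, h0⟩, Fin.forall_fin_two.2 ⟨?_, ?_⟩⟩
        · exact ⟨div_pos ht1 ht0, (div_lt_one ht0).2 h10⟩
        · exact ⟨div_pos h2 ht1, (div_lt_one ht1).2 h21⟩
      · refine funext (Fin.forall_fin_succ.2 ⟨rfl, Fin.forall_fin_two.2 ⟨?_, ?_⟩⟩)
        · show t 0 * (t 1 / t 0) = t 1
          exact mul_div_cancel₀ _ ht0.ne'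
        · show t 0 * (t 1 / t 0) * (t 2 / t 1) = t 2
          rw [mul_div_cancel₀ _ ht0.ne', mul_div_cancel₀ _ ht1.ne']
  · -- the Jacobian
    rw [hdet, abs_of_pos (mul_pos (pow_pos (hx 0).1 2) (hx 1).1)]

/-! ## The registered sub-goal -/

/-- **Stub E1 (`ebd_box_sub_simplex`; registered sub-goal of stmt-KontsevichZagierPeriods-3869,
line `SketchIdeator1`, layer `M3`).** The simplex substitution
`(x₀,x₁,x₂) ↦ (x₀, x₀x₁, x₀x₁x₂)` (rule 2, Jacobian `x₀²x₁`) identifies a representation `N` on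
the open unit cube `(0,1)³` with a representation `T` on the decreasing open simplex
`{0 < t₂ < t₁ < t₀ < 1}` with integrand `g` there, as soon as `N.integrand x = g (Φ x) · x₀²x₁` on
the cube — as ONE change-of-variables move `KZ.changeOfVariablesRel` of the Kontsevich–Zagier
calculus along the chart `ebd1_exists_simplexChart` (source `N`, image `T`).
[cite: KontsevichZagier2001, §1.2 rule (2)] -/
theorem ebd_box_sub_simplex :
    ∀ (g : (Fin 3 → ℝ) → ℝ) (N T : IntegralRep 3),
      N.domain = {x | ∀ i, x i ∈ Set.Ioo (0:ℝ) 1} →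
      T.domain = {t | 0 < t 2 ∧ t 2 < t 1 ∧ t 1 < t 0 ∧ t 0 < 1} →
      EqOn T.integrand g T.domain →
      EqOn N.integrand (fun x => g ![x 0, x 0 * x 1, x 0 * x 1 * x 2] * (x 0 ^ 2 * x 1)) N.domain →
      of N - of T ∈ relations := by
  intro g N T hNd hTd hTg hNi
  obtain ⟨Φ, Φ', hΦ, hsa, hderiv, hinj, himage, hdet⟩ := ebd1_exists_simplexChart
  have himage' : T.domain = Φ '' N.domain := by rw [hNd, himage, hTd]
  have hsa' : IsSemialgebraicMapOn ℚ N.domain Φ := by rw [hNd]; exact hsa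
  have hinj' : InjOn Φ N.domain := by rw [hNd]; exact hinj
  refine changeOfVariablesRel_subset_relations
    ⟨3, N, T, Φ, Φ', hsa', fun x _ => (hderiv x).hasFDerivWithinAt, hinj', himage',
      fun x hx => ?_, rfl⟩
  -- the pull-back identity on `N.domain`, Jacobian `|det DΦ| = x₀² x₁` included
  have hΦx : Φ x ∈ T.domain := himage' ▸ mem_image_of_mem _ hx
  have hx' : ∀ i, x i ∈ Set.Ioo (0:ℝ) 1 := by rw [hNd] at hx; exact hx
  rw [hNi hx, hTg hΦx, hdet x hx', hΦ x]

end Summit.KontsevichZagierPeriods.HurwitzMicroSectors.NormalFormPrinciple.PiBox.M3
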